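import Summits.QuantumFields.BalabanUV.Beta.GAN24.SymCorrectorZeroMode
import Summits.QuantumFields.BalabanUV.Beta.CombChartTransportLevel

/-!
# `BalabanUV.Beta.GAN24.SymCorrectorZeroSymbol` — binder row G-an2-4 ∕ (CONV-C), TRANSFER-III (the (α-0) chain at row D1's literal of record (III′)), the (C)-row at the comb
# data: **THE ZERO-FIBRE SYMBOL OF THE SYMMETRISED CORRECTOR IS THE IDENTITY** — the Lean face of Engine C's E0 mechanism (m2) «`Ĝ_sh(0) = Ĝ_bm(0)` EXACTLY: `Ψ̂_S` folds to the
# identity at zero block-momentum» (ttrl/balaban-calc/ccons/E0.md §4, the OWNER gan24-p1 g51's request R-GAN24P1-51-E0), in full generality: `Ψ_S` fixes every `n`-PERIODIC field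
# (not only constants); the block periodisation `Σ'_t (·)(x, z + n•t)` of a leg — the `q = 0` fibre of the `n`-block Bloch decomposition — does not see `Ψ̂_S` on either side in either
# orientation; the zero-fibre symbol of `Ψ̂_S ∘ X ∘ Ψ̂_Sᵀ` is that of `X` for every block-covariant `X` (so `GcombSh Lc j` and the rooted bm resolvent `coDressKBmAt ρ_c Lc (KInvStep Lc j)`
# have the SAME zero-fibre symbol at every level `j`); and `Ψ̂_S` in an INTERNAL position of a word `A ∘ Ψ̂_S ∘ K` drops out of the word's zero-fibre symbol as well.

NOT IN PRINT; OUR BOOKKEEPING (G-an2-4 crux team (2), leaf prover `b2b-balaban-gan24-formalise-leaf-01`, gen 84; [folklore] lattice-sum bookkeeping BY NAME over d1-formalise-leaf-03's TT1∕TT2a∕TT3a∕TT3b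
(`SymCorrectorForms.zetaS ∕ corrPsiS ∕ zetaS_shift ∕ depOn_zetaS`, `SymCorrectorKernel.comp_psiKS_inl ∕ comp_trK_psiKS_inl ∕ corrPsiS_apply_eq_sum ∕ shiftK_psiKS`, `SymCorrectorFace.faceWt`,
`SymCorrectorSlot`), leaf-06's `CompositeCorrectorKernel.apply_eq_sum_of_depOn`, MY `SymCorrectorZeroMode.tsum_faceSum_eq_zero ∕ summable_faceSum ∕ summable_slotPsiS`, an2's
`CombChartTransportLevel.GcombSh_eq_conj_psiKS_KInvStep` and `AxialDressingRooted.shiftK_coDressKBmAt_KInvStep ∕ decays_coDressKBmAt_KInvStep`; generic `d`, `0 < n`, `r ∈ box (d+1) n`; 0 `def`,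
0 cited facts, 0 `def … : Prop`, 0 sorry).  HONEST FRAMING (cell contract, verbatim): «discharging `BetaPertH` makes Bałaban's UV stability UNCONDITIONAL — a real constructive-QFT result; it is
NOT the continuum limit and NOT the Clay problem.»  HONEST DEPENDENCY (verbatim): «continuum YM on T⁴ ⇐ BetaPertH ∧ nine spine estimates (0/9 proved); BetaPertH ⇐ (D1) ∧ (D4) ∧ CAP+tail;
G-an2-4 gates asym, D1 and NE2/3/4.»

WHY.  E0 found by value (level 0 → 1, `(4,3)`) that the one-step charge of the comb-chart `T₂` tower does not depend on the dressing chart at all — (X) rows «sh+root = bm+root»,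
«bm+sym = sh+sym» — with mechanism (m2): on the zero fibre the (III′) and (E) step resolvents coincide.  MY `SymCorrectorZeroMode` ∕ `SymCorrectorExitFace` typed the TABLE-level
consequences the OWNER's twins consume (`zmode (𝒯₄ T) = zmode T`, `zmode (𝔇 (𝒯₄ Y)) = zmode (𝔇 Y)`); this file types the KERNEL-level mechanism itself, level-independently and for
internal positions too, so that every later zero-fibre fold of a word in `GcombSh Lc j` (the forcing `b̃′♮_j`'s words included) may replace `GcombSh Lc j` by the rooted bm resolvent.

WHAT.
* §1 `zetaS_sum_smul`; **`zetaS_blk_eq_sum_faceWt`** ∕ `zetaS_eq_sum_faceWt` (`ζ_S A Y = |box| · Σ_α Σ_{x ∈ blockSitesF n Y} faceWt r n α x · A α x`); **`summable_zetaS`** (summable fields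
  have block-summable defect potentials).
* §2 **`corrPsiS_eq_self_of_periodic`** ∕ `corrPhiS_eq_self_of_periodic`: `Ψ_S A = A`, `Φ_S A = A` for every `n`-periodic field (any root).
* §3 `summable_translates`; **`tsum_translates_slotPsiS`** (`Σ'_t slotPsiS r n F β (z + n•t) = Σ'_t F β (z + n•t)`), **`tsum_translates_corrPsiS`** (`Σ'_t (Ψ_S F)_α (x + n•t) = Σ'_t F_α (x + n•t)`).
* §4 kernels, one leg periodised: **`tsum_translates_comp_psiKS`** (`X ∘ Ψ̂`, right leg), **`tsum_translates_comp_trK_psiKS`** (`Ψ̂ᵀ ∘ X`, left leg), **`tsum_translates_psiKS_comp`** (`Ψ̂ ∘ X`,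
  left leg), **`tsum_translates_comp_trK_psiKS_right`** (`X ∘ Ψ̂ᵀ`, right leg) — every leg type.
* §5 `apply_translate_right_of_cov`, `tsum_translates_right_eq_left_of_cov`, `summable_row_psiKS_comp`; **`tsum_translates_conj_psiKS_of_cov`**: `Σ'_t (Ψ̂ ∘ X ∘ Ψ̂ᵀ)(x, z + n•t)_{ab} =
  Σ'_t X(x, z + n•t)_{ab}` for block-covariant `X` with summable rows and columns.  §5b `summable_uncurry_of_tsum_abs_le`, `tsum_abs_translates_le`, **`tsum_translates_comp_of_cov`**
  (periodised composition through a block-covariant factor), **`tsum_translates_comp_psiKS_comp`** (`Σ'_t (A ∘ Ψ̂ ∘ K)(x, z + n•t) = Σ'_t (A ∘ K)(x, z + n•t)`).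
* §6 (comb data) **`tsum_translates_GcombSh_eq`**: `Σ'_t GcombSh Lc j x (z + Lc•t) a b = Σ'_t (coDressKBmAt ρ_c Lc (KInvStep Lc j)) x (z + Lc•t) a b` — every `j`, every residue pair, every leg pair.
WHAT THIS IS NOT.  Asserts NO value of either symbol or of Bałaban's tables; the zero-fibre calculus of the T₂ WORDS (how `zmode` of `K3OfK ∕ W2SymOfK` words folds to symbols) is NOT typed
here; NOT (d′)∕(d″); the (III′) campaign is NOT asked (an2 W-4) — zero weight; NEVER «G-an2-4 closed» as (CONV-C); NOT D1, NOT `BetaPertH`, NOT continuum, NOT Clay; not in print.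
`bears_on: R4-G`.  2026-08-27.
-/

noncomputable section

open Finset
open scoped BigOperators
open Literature.MathematicalPhysics.QuantumFieldTheory
open Literature.MathematicalPhysics.QuantumFieldTheory.Balaban1983to89
open Literature.MathematicalPhysics.QuantumFieldTheory.Balaban1983to89.Beta
open KKTFluctuationEnergy (summable_blocks)
open ExpKernelCalculus (MKer Decays comp shiftK comp_shiftK)
open OneStepResolventKernel (Fib)
open OneStepKernelFamily (KInvStep)
open AffineAveraging (Site Form1 box toSite unitVec)
open AveragingContours (blk blk_block shift)
open AveragingContoursRooted (ctr ctrOff ctrOff_mem_box)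
open AxialProjector (blk_add_zsmul)
open InterLevelTransport (sublattice_injective)
open Summit.QuantumFields.BalabanUV.Beta.TameKernelCalculus (trK)
open Summit.QuantumFields.BalabanUV.Beta.AxialDressingRooted (coDressKBmAt decays_coDressKBmAt_KInvStep shiftK_coDressKBmAt_KInvStep)
open Summit.QuantumFields.BalabanUV.Beta.CombChartStepJets (GcombSh)
open Summit.QuantumFields.BalabanUV.Beta.CombChartTransportLevel (GcombSh_eq_conj_psiKS_KInvStep)
open Summit.QuantumFields.BalabanUV.Beta.CompositeCorrectorLocality (DepOn InBlockBond mem_inBlockBond blockSitesF mem_blockSitesF_of_blk_eq)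
open Summit.QuantumFields.BalabanUV.Beta.CompositeCorrectorKernel (indR indR_apply apply_eq_sum_of_depOn)
open Summit.QuantumFields.BalabanUV.Beta.SymCorrectorForms (zetaS zetaS_add zetaS_smul zetaS_zero zetaS_shift corrPsiS corrPsiS_apply depOn_zetaS)
open Summit.QuantumFields.BalabanUV.Beta.SymCorrectorKernel (psiKS shiftK_psiKS comp_psiKS_inl comp_psiKS_inr comp_trK_psiKS_inl comp_trK_psiKS_inr corrPsiS_apply_eq_sum)
open Summit.QuantumFields.BalabanUV.Beta.SymCorrectorFace (faceWt faceWtSum faceWtSum_nonneg abs_faceWt_le faceWt_shift faceSum slotPsiS)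
open Summit.QuantumFields.BalabanUV.Beta.SymCorrectorFaceDiv (mem_blockSitesF_iff)
open Summit.QuantumFields.BalabanUV.Beta.SymCorrectorFaceWeight (sum_blockSitesF_eq_sum_box)
open Summit.QuantumFields.BalabanUV.Beta.SymCorrectorSlot (comp_trK_psiKS_inl_left comp_trK_psiKS_inr_left comp_psiKS_inl_right comp_psiKS_inr_right)
open Summit.QuantumFields.BalabanUV.Beta.GAN24.SymCorrectorZeroMode (summable_faceSum tsum_faceSum_eq_zero)

namespace Summit.QuantumFields.BalabanUV.Beta.GAN24.SymCorrectorZeroSymbol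

variable {d : ℕ} {n : ℕ} (hn : 0 < n)
include hn

/-! ## §1 The defect potential of a block is the face-weight-weighted block sum; it is summable over the blocks -/

omit hn in
/-- [folklore] `ζ_S` of a finite linear combination. -/
theorem zetaS_sum_smul {ι : Type*} (ρ : Site (d + 1)) (n : ℕ) (s : Finset ι) (c : ι → ℝ) (B : ι → Form1 (d + 1) ℝ) :
    zetaS ρ n (∑ i ∈ s, c i • B i) = ∑ i ∈ s, c i • zetaS ρ n (B i) := by
  classical
  induction s using Finset.induction_on with
  | empty => simp [zetaS_zero]
  | insert a s ha ih => rw [Finset.sum_insert ha, Finset.sum_insert ha, zetaS_add, zetaS_smul, ih]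

variable {r : Fin (d + 1) → ℕ} (hr : r ∈ box (d + 1) n)
include hr

/-- [folklore] **THE DEFECT POTENTIAL OF THE BLOCK OF `w` IS THE FACE-WEIGHT-WEIGHTED BLOCK SUM OF THE FIELD**: `ζ_S A (blk n w) = |box| · Σ_α Σ_{x ∈ blockSitesF n (blk n w)} faceWt r n α x · A α x`
(locality TT1 `depOn_zetaS` + linearity — leaf-06's `apply_eq_sum_of_depOn` —; `ζ_S(e_{(α,x)})(blk x) = |box| · faceWt α x` by the definition of TT3a's face weight). -/
theorem zetaS_blk_eq_sum_faceWt (A : Form1 (d + 1) ℝ) (w : Site (d + 1)) :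
    zetaS (toSite r) n A (blk n w) = ((box (d + 1) n).card : ℝ) * ∑ α : Fin (d + 1), ∑ x ∈ blockSitesF n (blk n w), faceWt r n α x * A α x := by
  classical
  have hcard : ((box (d + 1) n).card : ℝ) ≠ 0 := by
    have : 0 < (box (d + 1) n).card := Finset.card_pos.2 ⟨fun _ => 0, Fintype.mem_piFinset.2 fun _ => Finset.mem_range.2 hn⟩
    exact_mod_cast this.ne'
  -- the functional `A ↦ ζ_S A (blk (·))` as a `Form1 → Form1` operator (constant in the direction argument)
  have h := apply_eq_sum_of_depOn (T := fun A => fun (_ : Fin (d + 1)) (x' : Site (d + 1)) => zetaS (toSite r) n A (blk n x'))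
    (α := 0) (x := w) (P := InBlockBond n (blk n w)) (S := Finset.univ ×ˢ blockSitesF n (blk n w)) (depOn_zetaS hn hr (blk n w))
    (fun p hp => Finset.mem_product.2 ⟨Finset.mem_univ _, mem_blockSitesF_of_blk_eq hn (mem_inBlockBond.1 hp).1⟩)
    (fun s c B => by funext α' x'; rw [zetaS_sum_smul]; simp only [Finset.sum_apply, Pi.smul_apply, smul_eq_mul]) A
  rw [h, Finset.sum_product, Finset.mul_sum]
  refine Finset.sum_congr rfl fun α _ => ?_
  rw [Finset.mul_sum]
  refine Finset.sum_congr rfl fun x hx => ?_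
  rw [← (mem_blockSitesF_iff hn).1 hx, faceWt, ← mul_assoc, ← mul_assoc, mul_inv_cancel₀ hcard, one_mul]

/-- [folklore] … the same for any block `Y` (`Y = blk n (n•Y)`). -/
theorem zetaS_eq_sum_faceWt (A : Form1 (d + 1) ℝ) (Y : Site (d + 1)) :
    zetaS (toSite r) n A Y = ((box (d + 1) n).card : ℝ) * ∑ α : Fin (d + 1), ∑ x ∈ blockSitesF n Y, faceWt r n α x * A α x := by
  have hY : blk n ((n : ℤ) • Y) = Y := AxialProjector.blk_zsmul hn Y
  rw [← hY, zetaS_blk_eq_sum_faceWt hn hr A]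

/-- [folklore] **THE DEFECT POTENTIAL OF A SUMMABLE FIELD IS SUMMABLE OVER THE BLOCKS** (`|faceWt| ≤ faceWtSum`; block regrouping of the summable `|A α ·|`). -/
theorem summable_zetaS {A : Form1 (d + 1) ℝ} (hA : ∀ κ, Summable (A κ)) : Summable fun Y : Site (d + 1) => zetaS (toSite r) n A Y := by
  haveI : NeZero n := ⟨hn.ne'⟩
  have hmaj : Summable fun Y : Site (d + 1) => ((box (d + 1) n).card : ℝ) * (faceWtSum r n *
      ∑ α : Fin (d + 1), ∑ b ∈ box (d + 1) n, |A α ((n : ℤ) • Y + toSite b)|) :=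
    ((summable_sum fun α _ => summable_blocks (N := n) (hA α).abs).mul_left _).mul_left _
  refine Summable.of_norm_bounded hmaj fun Y => ?_
  rw [Real.norm_eq_abs, zetaS_eq_sum_faceWt hn hr A Y, abs_mul, Nat.abs_cast]
  refine mul_le_mul_of_nonneg_left ?_ (Nat.cast_nonneg _)
  rw [Finset.mul_sum]
  refine (Finset.abs_sum_le_sum_abs _ _).trans (Finset.sum_le_sum fun α _ => ?_)
  rw [sum_blockSitesF_eq_sum_box hn (fun x => faceWt r n α x * A α x) Y, Finset.mul_sum]
  refine (Finset.abs_sum_le_sum_abs _ _).trans (Finset.sum_le_sum fun b _ => ?_)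
  rw [abs_mul]
  exact mul_le_mul_of_nonneg_right (abs_faceWt_le hn r α _) (abs_nonneg _)

/-! ## §2 `Ψ_S` fixes every `n`-periodic field -/

omit hn hr in
/-- **`Ψ_S` FIXES EVERY `n`-PERIODIC FIELD** [our bookkeeping; folklore composition] (any root `ρ`): `(∀ κ x t, A κ (x + n•t) = A κ x) ⟹ Ψ_S A = A` — the defect potential
`ζ_S A` of a periodic field is the same on every block (TT1 `zetaS_shift`), so its block-constant extension has no gradient.  This is «`Ψ̂_S` folds to the identity at zero block-momentum»
(Engine C E0 §4 (m2)) on the whole zero fibre, not only on constants. -/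
theorem corrPsiS_eq_self_of_periodic (ρ : Site (d + 1)) {A : Form1 (d + 1) ℝ} (hper : ∀ (κ : Fin (d + 1)) (x t : Site (d + 1)), A κ (x + (n : ℤ) • t) = A κ x) :
    corrPsiS ρ n A = A := by
  have hz : ∀ Y v : Site (d + 1), zetaS ρ n A (Y + v) = zetaS ρ n A Y := by
    intro Y v
    have hs : shift ((n : ℤ) • v) A = A := by funext κ x; exact hper κ x v
    have h := zetaS_shift ρ n A v
    rw [hs] at h
    exact (congrFun h Y).symm
  funext α x
  rw [corrPsiS_apply, show blk n (x + unitVec α) = blk n x + (blk n (x + unitVec α) - blk n x) by abel, hz, sub_self, mul_zero, add_zero]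

omit hn hr in
/-- [folklore] **`Φ_S` FIXES EVERY `n`-PERIODIC FIELD TOO** (`Φ_S A = A − |box|⁻¹ • dz (ext n (ζ_S A))`, same constancy of `ζ_S A`). -/
theorem corrPhiS_eq_self_of_periodic (ρ : Site (d + 1)) {A : Form1 (d + 1) ℝ} (hper : ∀ (κ : Fin (d + 1)) (x t : Site (d + 1)), A κ (x + (n : ℤ) • t) = A κ x) :
    SymCorrectorForms.corrPhiS ρ n A = A := by
  have hz : ∀ Y v : Site (d + 1), zetaS ρ n A (Y + v) = zetaS ρ n A Y := fun Y v => by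
    have h := zetaS_shift ρ n A v
    rw [show shift ((n : ℤ) • v) A = A from funext fun κ => funext fun x => hper κ x v] at h
    exact (congrFun h Y).symm
  funext α x
  rw [SymCorrectorForms.corrPhiS_apply, show blk n (x + unitVec α) = blk n x + (blk n (x + unitVec α) - blk n x) by abel, hz, sub_self, mul_zero, sub_zero]

/-! ## §3 Block periodisation of one slot: the transports preserve the sum over the translates -/

omit hn hr in
/-- [folklore] A summable function restricted to a coset of `n•ℤ^{d+1}` is summable. -/
theorem summable_translates [NeZero n] {f : Site (d + 1) → ℝ} (hf : Summable f) (z : Site (d + 1)) : Summable fun t : Site (d + 1) => f (z + (n : ℤ) • t) :=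
  (hf.comp_injective (sublattice_injective n z)).congr fun t => by simp only [Function.comp_apply, add_comm]

omit hr in
/-- **THE SLOT TRANSPORT PRESERVES THE SUM OVER THE BLOCK TRANSLATES OF A SLOT** [folklore]: for a bond family with summable components,
`Σ'_t slotPsiS r n F β (z + n•t) = Σ'_t F β (z + n•t)` (block covariance of the face weight; the face sums over ALL blocks total zero, MY `tsum_faceSum_eq_zero`). -/
theorem tsum_translates_slotPsiS {F : Form1 (d + 1) ℝ} (hF : ∀ κ, Summable (F κ)) (β : Fin (d + 1)) (z : Site (d + 1)) :
    ∑' t : Site (d + 1), slotPsiS r n F β (z + (n : ℤ) • t) = ∑' t : Site (d + 1), F β (z + (n : ℤ) • t) := by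
  haveI : NeZero n := ⟨hn.ne'⟩
  have e : ∀ t : Site (d + 1), slotPsiS r n F β (z + (n : ℤ) • t) = F β (z + (n : ℤ) • t) + faceWt r n β z * faceSum n F (blk n z + t) := by
    intro t
    show F β (z + (n : ℤ) • t) + faceWt r n β (z + (n : ℤ) • t) • faceSum n F (blk n (z + (n : ℤ) • t)) = _
    rw [smul_eq_mul, faceWt_shift hn, blk_add_zsmul hn]
  have hs : Summable fun t : Site (d + 1) => faceSum n F (blk n z + t) := (summable_faceSum hn hF).comp_injective (add_right_injective (blk n z))
  rw [tsum_congr e, (summable_translates (hF β) z).tsum_add (hs.mul_left _), tsum_mul_left,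
    show (∑' t : Site (d + 1), faceSum n F (blk n z + t)) = ∑' Y, faceSum n F Y from (Equiv.addLeft (blk n z)).tsum_eq (faceSum n F),
    tsum_faceSum_eq_zero hn hF, mul_zero, add_zero]

/-- **THE CORRECTOR `Ψ_S` PRESERVES THE SUM OVER THE BLOCK TRANSLATES OF A BOND** [folklore]: for a field with summable components and an in-block root,
`Σ'_t (Ψ_S F)_α (x + n•t) = Σ'_t F_α (x + n•t)` (the gradient term telescopes over the blocks: `ζ_S F` is summable, §1). -/
theorem tsum_translates_corrPsiS {F : Form1 (d + 1) ℝ} (hF : ∀ κ, Summable (F κ)) (α : Fin (d + 1)) (x : Site (d + 1)) :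
    ∑' t : Site (d + 1), corrPsiS (toSite r) n F α (x + (n : ℤ) • t) = ∑' t : Site (d + 1), F α (x + (n : ℤ) • t) := by
  haveI : NeZero n := ⟨hn.ne'⟩
  set c : ℝ := ((box (d + 1) n).card : ℝ)⁻¹ with hc
  have e : ∀ t : Site (d + 1), corrPsiS (toSite r) n F α (x + (n : ℤ) • t)
      = F α (x + (n : ℤ) • t) + c * (zetaS (toSite r) n F (blk n (x + unitVec α) + t) - zetaS (toSite r) n F (blk n x + t)) := by
    intro t
    rw [corrPsiS_apply, show x + (n : ℤ) • t + unitVec α = (x + unitVec α) + (n : ℤ) • t by abel, blk_add_zsmul hn, blk_add_zsmul hn]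
  have hζ := summable_zetaS hn hr hF
  have h1 : Summable fun t : Site (d + 1) => zetaS (toSite r) n F (blk n (x + unitVec α) + t) := hζ.comp_injective (add_right_injective _)
  have h0 : Summable fun t : Site (d + 1) => zetaS (toSite r) n F (blk n x + t) := hζ.comp_injective (add_right_injective _)
  rw [tsum_congr e, (summable_translates (hF α) x).tsum_add ((h1.sub h0).mul_left c), tsum_mul_left, h1.tsum_sub h0,
    show (∑' t : Site (d + 1), zetaS (toSite r) n F (blk n (x + unitVec α) + t)) = ∑' Y, zetaS (toSite r) n F Y from
      (Equiv.addLeft (blk n (x + unitVec α))).tsum_eq _,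
    show (∑' t : Site (d + 1), zetaS (toSite r) n F (blk n x + t)) = ∑' Y, zetaS (toSite r) n F Y from (Equiv.addLeft (blk n x)).tsum_eq _,
    sub_self, mul_zero, add_zero]

/-! ## §4 Kernels: `Ψ̂_S` on either side, in either orientation, preserves the block periodisation of the touched leg -/

/-- [folklore] **RIGHT CORRECTOR, RIGHT LEG PERIODISED**: `Σ'_t (X ∘ Ψ̂)(x, z + n•t)_{ab} = Σ'_t X(x, z + n•t)_{ab}` (summable rows; TT3b: the right field leg is a slot transport). -/
theorem tsum_translates_comp_psiKS (X : MKer (d + 1) (Fib d)) (x : Site (d + 1)) (a b : Fib d) (hX : ∀ b' : Fib d, Summable fun w => X x w a b')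
    (z : Site (d + 1)) : ∑' t : Site (d + 1), comp X (psiKS r n) x (z + (n : ℤ) • t) a b = ∑' t : Site (d + 1), X x (z + (n : ℤ) • t) a b := by
  rcases b with β | m
  · rw [tsum_congr fun t => comp_psiKS_inl_right hn hr X x (z + (n : ℤ) • t) a β]
    exact tsum_translates_slotPsiS hn (F := fun κ u => X x u a (Sum.inl κ)) (fun κ => hX (Sum.inl κ)) β z
  · exact tsum_congr fun t => comp_psiKS_inr_right X x _ a m

/-- [folklore] **LEFT TRANSPOSED CORRECTOR, LEFT LEG PERIODISED**: `Σ'_t (Ψ̂ᵀ ∘ X)(x + n•t, w)_{ab} = Σ'_t X(x + n•t, w)_{ab}` (summable columns). -/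
theorem tsum_translates_comp_trK_psiKS (X : MKer (d + 1) (Fib d)) (w : Site (d + 1)) (a b : Fib d) (hX : ∀ a' : Fib d, Summable fun u => X u w a' b)
    (x : Site (d + 1)) : ∑' t : Site (d + 1), comp (trK (psiKS r n)) X (x + (n : ℤ) • t) w a b = ∑' t : Site (d + 1), X (x + (n : ℤ) • t) w a b := by
  rcases a with β | m
  · rw [tsum_congr fun t => comp_trK_psiKS_inl_left hn hr X (x + (n : ℤ) • t) w β b]
    exact tsum_translates_slotPsiS hn (F := fun κ u => X u w (Sum.inl κ) b) (fun κ => hX (Sum.inl κ)) β x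
  · exact tsum_congr fun t => comp_trK_psiKS_inr_left X _ w m b

/-- [folklore] **LEFT CORRECTOR, LEFT LEG PERIODISED**: `Σ'_t (Ψ̂ ∘ X)(x + n•t, z)_{ab} = Σ'_t X(x + n•t, z)_{ab}` (summable columns; TT2a's apply bridge `comp_psiKS_inl` + §3). -/
theorem tsum_translates_psiKS_comp (X : MKer (d + 1) (Fib d)) (z : Site (d + 1)) (a b : Fib d) (hX : ∀ a' : Fib d, Summable fun y => X y z a' b)
    (x : Site (d + 1)) : ∑' t : Site (d + 1), comp (psiKS r n) X (x + (n : ℤ) • t) z a b = ∑' t : Site (d + 1), X (x + (n : ℤ) • t) z a b := by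
  rcases a with α | m
  · rw [tsum_congr fun t => comp_psiKS_inl hn hr X (x + (n : ℤ) • t) z α b]
    exact tsum_translates_corrPsiS hn hr (F := fun κ y => X y z (Sum.inl κ) b) (fun κ => hX (Sum.inl κ)) α x
  · exact tsum_congr fun t => comp_psiKS_inr X _ z m b

/-- [folklore] **RIGHT TRANSPOSED CORRECTOR, RIGHT LEG PERIODISED**: `Σ'_t (X ∘ Ψ̂ᵀ)(x, z + n•t)_{ab} = Σ'_t X(x, z + n•t)_{ab}` (summable rows). -/
theorem tsum_translates_comp_trK_psiKS_right (X : MKer (d + 1) (Fib d)) (x : Site (d + 1)) (a b : Fib d) (hX : ∀ b' : Fib d, Summable fun y => X x y a b')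
    (z : Site (d + 1)) : ∑' t : Site (d + 1), comp X (trK (psiKS r n)) x (z + (n : ℤ) • t) a b = ∑' t : Site (d + 1), X x (z + (n : ℤ) • t) a b := by
  rcases b with β | m
  · rw [tsum_congr fun t => comp_trK_psiKS_inl hn hr X x (z + (n : ℤ) • t) a β]
    exact tsum_translates_corrPsiS hn hr (F := fun κ y => X x y a (Sum.inl κ)) (fun κ => hX (Sum.inl κ)) β z
  · exact tsum_congr fun t => comp_trK_psiKS_inr X x _ a m

/-! ## §5 The zero-fibre symbol of a conjugate `Ψ̂_S ∘ X ∘ Ψ̂_Sᵀ` of a block-covariant kernel is that of `X` -/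

omit hn hr in
/-- [folklore] For a block-covariant kernel, periodising the right leg is periodising the left leg: `M(x, z + n•t) = M(x − n•t, z)`. -/
theorem apply_translate_right_of_cov {M : MKer (d + 1) (Fib d)} (hM : ∀ t : Site (d + 1), shiftK (-((n : ℤ) • t)) M = M) (x z t : Site (d + 1)) (a b : Fib d) :
    M x (z + (n : ℤ) • t) a b = M (x - (n : ℤ) • t) z a b := by
  have h := congrFun (congrFun (congrFun (congrFun (hM t) x) (z + (n : ℤ) • t)) a) b
  simp only [shiftK] at h
  rw [← h, show z + (n : ℤ) • t + -((n : ℤ) • t) = z by abel, ← sub_eq_add_neg]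

omit hn hr in
/-- [folklore] For a block-covariant kernel the two one-leg periodisations agree: `Σ'_t M(x, z + n•t) = Σ'_t M(x + n•t, z)`. -/
theorem tsum_translates_right_eq_left_of_cov {M : MKer (d + 1) (Fib d)} (hM : ∀ t : Site (d + 1), shiftK (-((n : ℤ) • t)) M = M) (x z : Site (d + 1)) (a b : Fib d) :
    ∑' t : Site (d + 1), M x (z + (n : ℤ) • t) a b = ∑' t : Site (d + 1), M (x + (n : ℤ) • t) z a b := by
  rw [tsum_congr fun t => apply_translate_right_of_cov hM x z t a b]
  rw [show (∑' t : Site (d + 1), M (x - (n : ℤ) • t) z a b) = ∑' t : Site (d + 1), M (x + (n : ℤ) • t) z a b from by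
    rw [← (Equiv.neg (Site (d + 1))).tsum_eq (fun t => M (x + (n : ℤ) • t) z a b)]
    exact tsum_congr fun t => by simp [sub_eq_add_neg, smul_neg]]

/-- [folklore] A row of `Ψ̂ ∘ X` is summable when the rows of `X` are (the left field leg of `Ψ̂ ∘ X` is a FINITE combination of rows of `X`, TT2a `corrPsiS_apply_eq_sum`). -/
theorem summable_row_psiKS_comp {X : MKer (d + 1) (Fib d)} (hX : ∀ (y : Site (d + 1)) (a b : Fib d), Summable fun w => X y w a b) (x : Site (d + 1)) (a b : Fib d) :
    Summable fun w => comp (psiKS r n) X x w a b := by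
  classical
  rcases a with α | m
  · have e : ∀ w, comp (psiKS r n) X x w (Sum.inl α) b
        = ∑ p ∈ CompositeCorrectorLocality.corrDep n α x, corrPsiS (toSite r) n (indR p.1 p.2) α x * X p.2 w (Sum.inl p.1) b := fun w => by
      rw [comp_psiKS_inl hn hr]
      exact corrPsiS_apply_eq_sum hn hr α x (fun p hp => CompositeCorrectorLocality.mem_corrDep_of_mem_corrReads hn hp) _
    simp_rw [e]
    exact summable_sum fun p _ => (hX _ _ _).mul_left _
  · simp_rw [comp_psiKS_inr]
    exact hX x _ b

/-- **THE ZERO-FIBRE SYMBOL OF `Ψ̂_S ∘ X ∘ Ψ̂_Sᵀ` IS THAT OF `X`** [our bookkeeping; folklore composition]: for a block-covariant kernel `X` (`shiftK (−n•t) X = X`) with summable rows and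
columns, `0 < n`, `r ∈ box (d+1) n`, `Ψ̂ = psiKS r n`: `Σ'_t (Ψ̂ ∘ X ∘ Ψ̂ᵀ)(x, z + n•t)_{ab} = Σ'_t X(x, z + n•t)_{ab}` for every residue pair `(x, z)` and EVERY leg pair — the block
periodisation (the `q = 0` fibre of the `n`-block Bloch decomposition) does not see the corrector.  The Lean face of Engine C's E0 mechanism (m2) «`Ĝ_sh(0) = Ĝ_bm(0)` exactly — `Ψ̂_S`
folds to the identity at zero block-momentum» (ccons/E0.md §4), level-independent. -/
theorem tsum_translates_conj_psiKS_of_cov {X : MKer (d + 1) (Fib d)} (hXcov : ∀ t : Site (d + 1), shiftK (-((n : ℤ) • t)) X = X)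
    (hrow : ∀ (x : Site (d + 1)) (a b : Fib d), Summable fun y => X x y a b) (hcol : ∀ (z : Site (d + 1)) (a b : Fib d), Summable fun y => X y z a b)
    (x z : Site (d + 1)) (a b : Fib d) :
    ∑' t : Site (d + 1), comp (comp (psiKS r n) X) (trK (psiKS r n)) x (z + (n : ℤ) • t) a b = ∑' t : Site (d + 1), X x (z + (n : ℤ) • t) a b := by
  have hΨ : ∀ t : Site (d + 1), shiftK (-((n : ℤ) • t)) (psiKS r n) = psiKS r n := fun t => by rw [← smul_neg]; exact shiftK_psiKS hn (-t)
  have hWcov : ∀ t : Site (d + 1), shiftK (-((n : ℤ) • t)) (comp (psiKS r n) X) = comp (psiKS r n) X := fun t => by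
    rw [← comp_shiftK, hΨ, hXcov]
  -- drop the right `Ψ̂ᵀ` (right leg periodised; rows of `Ψ̂ ∘ X` summable)
  rw [tsum_translates_comp_trK_psiKS_right hn hr (comp (psiKS r n) X) x a b (fun b' => summable_row_psiKS_comp hn hr hrow x a b') z,
    -- move the periodisation to the left leg (covariance of `Ψ̂ ∘ X`), drop the left `Ψ̂`, move back
    tsum_translates_right_eq_left_of_cov hWcov, tsum_translates_psiKS_comp hn hr X z a b (fun a' => hcol z a' b) x,
    ← tsum_translates_right_eq_left_of_cov hXcov]

/-! ## §5b Internal positions: `Ψ̂_S` between a row-summable kernel and a block-covariant column-summable kernel drops out of the zero-fibre symbol -/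

omit hn hr in
/-- [folklore] Fubini brick (lit-balaban's `ResolventCompositionStepB.summable_uncurry_of_tsum_abs_le`, restated to keep the import closure small): rows summable with summable
`ℓ¹` masses ⟹ jointly summable. -/
theorem summable_uncurry_of_tsum_abs_le {f : Site (d + 1) → Site (d + 1) → ℝ} {B : Site (d + 1) → ℝ} (hfy : ∀ y, Summable (f y))
    (hB : ∀ y, ∑' x, |f y x| ≤ B y) (hBs : Summable B) : Summable (Function.uncurry f) := by
  have hG : Summable (fun p : Site (d + 1) × Site (d + 1) => |f p.1 p.2|) := by
    refine (summable_prod_of_nonneg (fun p => abs_nonneg _)).mpr ⟨fun y => (hfy y).abs, ?_⟩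
    exact Summable.of_nonneg_of_le (fun y => tsum_nonneg fun x => abs_nonneg _) hB hBs
  exact summable_abs_iff.mp hG

omit hn hr in
/-- [folklore] A coset subseries of a summable nonnegative series is dominated by the whole series: `Σ'_t |g (y + n•t)| ≤ Σ'_w |g w|`. -/
theorem tsum_abs_translates_le [NeZero n] {g : Site (d + 1) → ℝ} (hg : Summable g) (y : Site (d + 1)) :
    ∑' t : Site (d + 1), |g (y + (n : ℤ) • t)| ≤ ∑' w, |g w| := by
  have h := tsum_comp_le_tsum_of_inj hg.abs (fun _ => abs_nonneg _) (i := fun t : Site (d + 1) => y + (n : ℤ) • t)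
    (fun t t' e => sublattice_injective n y (by simpa only [add_comm] using e))
  simpa only [Function.comp_def] using h

omit hn hr in
/-- [folklore] **PERIODISED COMPOSITION**: for `W` with summable rows at `x` and a block-covariant `K` with summable columns at `z`,
`Σ'_t (W ∘ K)(x, z + n•t)_{ab} = Σ_f Σ'_y (Σ'_t W(x, y + n•t)_{af}) · K(y, z)_{fb}` — the right leg's periodisation moves THROUGH the block-covariant factor onto the left factor's
right leg (covariance `K(y, z + n•t) = K(y − n•t, z)`, re-indexing `y ↦ y + n•t`, Fubini by the `ℓ¹` brick). -/
theorem tsum_translates_comp_of_cov [NeZero n] {W K : MKer (d + 1) (Fib d)} {x z : Site (d + 1)} {a b : Fib d}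
    (hW : ∀ f : Fib d, Summable fun y => W x y a f) (hKcov : ∀ t : Site (d + 1), shiftK (-((n : ℤ) • t)) K = K) (hK : ∀ f : Fib d, Summable fun y => K y z f b) :
    ∑' t : Site (d + 1), comp W K x (z + (n : ℤ) • t) a b = ∑ f : Fib d, ∑' y : Site (d + 1), (∑' t : Site (d + 1), W x (y + (n : ℤ) • t) a f) * K y z f b := by
  -- unfold the composition and move the translate onto the left leg of `K`, then onto the right leg of `W`
  have e1 : ∀ t : Site (d + 1), comp W K x (z + (n : ℤ) • t) a b = ∑' y : Site (d + 1), ∑ f : Fib d, W x (y + (n : ℤ) • t) a f * K y z f b := by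
    intro t
    unfold ExpKernelCalculus.comp
    rw [← (Equiv.addRight ((n : ℤ) • t)).tsum_eq]
    refine tsum_congr fun y => Finset.sum_congr rfl fun f _ => ?_
    rw [Equiv.coe_addRight, apply_translate_right_of_cov hKcov, add_sub_cancel_right]
  rw [tsum_congr e1]
  -- Fubini: the (t, y) family is jointly summable (row masses `(Σ_f Σ'_w |W x w a f|) · |K y z f b|`)
  have hrow : ∀ y : Site (d + 1), Summable fun t : Site (d + 1) => ∑ f : Fib d, W x (y + (n : ℤ) • t) a f * K y z f b :=
    fun y => summable_sum fun f _ => (summable_translates (hW f) y).mul_right _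
  have hs : Summable (Function.uncurry fun (y t : Site (d + 1)) => ∑ f : Fib d, W x (y + (n : ℤ) • t) a f * K y z f b) := by
    refine summable_uncurry_of_tsum_abs_le hrow (B := fun y => ∑ f : Fib d, (∑' w, |W x w a f|) * |K y z f b|) (fun y => ?_)
      (summable_sum fun f _ => (hK f).abs.mul_left _)
    have hle : ∀ t : Site (d + 1), |∑ f : Fib d, W x (y + (n : ℤ) • t) a f * K y z f b| ≤ ∑ f : Fib d, |W x (y + (n : ℤ) • t) a f| * |K y z f b| :=
      fun t => (Finset.abs_sum_le_sum_abs _ _).trans (le_of_eq (Finset.sum_congr rfl fun f _ => abs_mul _ _))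
    have hsf : ∀ f : Fib d, Summable fun t : Site (d + 1) => |W x (y + (n : ℤ) • t) a f| * |K y z f b| :=
      fun f => ((summable_translates (hW f) y).abs).mul_right _
    calc ∑' t : Site (d + 1), |∑ f : Fib d, W x (y + (n : ℤ) • t) a f * K y z f b|
        ≤ ∑' t : Site (d + 1), ∑ f : Fib d, |W x (y + (n : ℤ) • t) a f| * |K y z f b| := Summable.tsum_le_tsum hle (hrow y).abs (summable_sum fun f _ => hsf f)
      _ = ∑ f : Fib d, (∑' t : Site (d + 1), |W x (y + (n : ℤ) • t) a f|) * |K y z f b| := by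
          rw [Summable.tsum_finsetSum fun f _ => hsf f]
          exact Finset.sum_congr rfl fun f _ => tsum_mul_right
      _ ≤ ∑ f : Fib d, (∑' w, |W x w a f|) * |K y z f b| :=
          Finset.sum_le_sum fun f _ => mul_le_mul_of_nonneg_right (tsum_abs_translates_le (hW f) y) (abs_nonneg _)
  rw [hs.tsum_comm]
  -- inner: a finite sum of products with a `t`-independent factor
  have e2 : ∀ y : Site (d + 1), (∑' t : Site (d + 1), ∑ f : Fib d, W x (y + (n : ℤ) • t) a f * K y z f b)
      = ∑ f : Fib d, (∑' t : Site (d + 1), W x (y + (n : ℤ) • t) a f) * K y z f b := by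
    intro y
    rw [Summable.tsum_finsetSum fun f _ => (summable_translates (hW f) y).mul_right _]
    exact Finset.sum_congr rfl fun f _ => tsum_mul_right
  rw [tsum_congr e2]
  -- outer: the `y`-series of each product converges (bounded first factor, summable column of `K`)
  refine Summable.tsum_finsetSum fun f _ => ?_
  refine Summable.of_norm_bounded ((hK f).abs.mul_left (∑' w, |W x w a f|)) fun y => ?_
  rw [Real.norm_eq_abs, abs_mul]
  refine mul_le_mul_of_nonneg_right ?_ (abs_nonneg _)
  have h1 : |∑' t : Site (d + 1), W x (y + (n : ℤ) • t) a f| ≤ ∑' t : Site (d + 1), |W x (y + (n : ℤ) • t) a f| := by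
    have h := norm_tsum_le_tsum_norm (summable_translates (n := n) (hW f) y).norm
    simpa only [Real.norm_eq_abs] using h
  exact h1.trans (tsum_abs_translates_le (hW f) y)

/-- **`Ψ̂_S` IN AN INTERNAL POSITION DROPS OUT OF THE ZERO-FIBRE SYMBOL** [our bookkeeping; folklore composition]: for `A` with summable rows, a block-covariant `K` with summable
columns, `0 < n`, `r ∈ box (d+1) n`, `Ψ̂ = psiKS r n`: `Σ'_t (A ∘ Ψ̂ ∘ K)(x, z + n•t)_{ab} = Σ'_t (A ∘ K)(x, z + n•t)_{ab}` — §5b's periodised composition on both sides and §4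
`tsum_translates_comp_psiKS` on the inner factor.  With §5 this is why Engine C's E0 (X) rows coincide chart by chart for the WHOLE one-step charge (linear part AND forcing): every
`q = 0` fold of a word in block-covariant kernels is blind to every `Ψ̂_S` it contains. -/
theorem tsum_translates_comp_psiKS_comp [NeZero n] {A K : MKer (d + 1) (Fib d)} {x z : Site (d + 1)} {a b : Fib d}
    (hA : ∀ (y : Site (d + 1)) (f : Fib d), Summable fun w => A y w a f) (hKcov : ∀ t : Site (d + 1), shiftK (-((n : ℤ) • t)) K = K)
    (hK : ∀ f : Fib d, Summable fun y => K y z f b) :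
    ∑' t : Site (d + 1), comp (comp A (psiKS r n)) K x (z + (n : ℤ) • t) a b = ∑' t : Site (d + 1), comp A K x (z + (n : ℤ) • t) a b := by
  -- rows of `A ∘ Ψ̂` are summable: its right field leg is the slot transport of `A`'s row family (TT3b), MY `summable_slotPsiS`
  have hAΨ : ∀ f : Fib d, Summable fun y => comp A (psiKS r n) x y a f := by
    intro f
    rcases f with β | m
    · have e : ∀ y, comp A (psiKS r n) x y a (Sum.inl β) = slotPsiS r n (fun κ u => A x u a (Sum.inl κ)) β y := fun y => comp_psiKS_inl_right hn hr A x y a β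
      simp_rw [e]
      exact SymCorrectorZeroMode.summable_slotPsiS hn r (T := fun κ u => A x u a (Sum.inl κ)) (fun κ => hA x (Sum.inl κ)) β
    · simp_rw [comp_psiKS_inr_right]
      exact hA x (Sum.inr m)
  rw [tsum_translates_comp_of_cov hAΨ hKcov hK, tsum_translates_comp_of_cov (hA x) hKcov hK]
  refine Finset.sum_congr rfl fun f _ => tsum_congr fun y => ?_
  rw [tsum_translates_comp_psiKS hn hr A x a f (hA x) y]

end Summit.QuantumFields.BalabanUV.Beta.GAN24.SymCorrectorZeroSymbol

/-! ## §6 At the comb data: the comb-chart resolvent and the rooted bm resolvent have the same zero-fibre symbol, at every level -/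

namespace Summit.QuantumFields.BalabanUV.Beta.GAN24.SymCorrectorZeroSymbol

variable {d : ℕ} (Lc : ℕ) [NeZero Lc]

/-- **`Ĝ_sh(0) = Ĝ_bm(0)` AT EVERY LEVEL** [our bookkeeping; folklore composition] (Engine C E0 §4 (m2), by value at `(4,3)`, `j = 0` — here for every `d`, `Lc`, `j`, every residue pair and
EVERY leg pair): `Σ'_t GcombSh Lc j x (z + Lc•t) a b = Σ'_t (coDressKBmAt ρ_c Lc (KInvStep Lc j)) x (z + Lc•t) a b` — an2's chart transport `GcombSh Lc j = Ψ̂_S ∘ coDressKBmAt ρ_c Lc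
(KInvStep Lc j) ∘ Ψ̂_Sᵀ` (`CombChartTransportLevel.GcombSh_eq_conj_psiKS_KInvStep`) ⨾ §5 (block covariance `shiftK_coDressKBmAt_KInvStep`, rows ∕ columns summable by
`decays_coDressKBmAt_KInvStep`).  Asserts NO value of either symbol. -/
theorem tsum_translates_GcombSh_eq (j : ℕ) (x z : Site (d + 1)) (a b : Fib d) :
    ∑' t : Site (d + 1), GcombSh (d := d) Lc j x (z + (Lc : ℤ) • t) a b
      = ∑' t : Site (d + 1), coDressKBmAt (ctr (d + 1) Lc) Lc (KInvStep (d := d) Lc j) x (z + (Lc : ℤ) • t) a b := by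
  have hLc : 0 < Lc := Nat.pos_of_ne_zero (NeZero.ne Lc)
  have hr : ctrOff (d + 1) Lc ∈ box (d + 1) Lc := ctrOff_mem_box hLc
  obtain ⟨δ, C, hδ, -, hG⟩ := decays_coDressKBmAt_KInvStep (d := d) (Lc := Lc) hr j
  rw [GcombSh_eq_conj_psiKS_KInvStep Lc j]
  exact tsum_translates_conj_psiKS_of_cov hLc hr (shiftK_coDressKBmAt_KInvStep (ctr (d + 1) Lc) j)
    (fun x a b => AxialDressing.summable_row_of_decays hG hδ x a b) (fun z a b => AxialDressing.summable_col_of_decays hG hδ z a b) x z a b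

end Summit.QuantumFields.BalabanUV.Beta.GAN24.SymCorrectorZeroSymbol

end
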